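import Literature.NumberTheory.Transcendental.KZTorusLogRep
import Literature.NumberTheory.Transcendental.KZUnfolding
import Literature.NumberTheory.Transcendental.KZLogCalculusProofs

/-!
# Jensen is scissors — toolkit I: bookkeeping inside a scissors-closed subgroup

Support file for item stmt-KontsevichZagierPeriods-5204 (`JensenIsScissors`, route
KontsevichZagierPeriods/K2SymbolChains). The item asks for a chain inside the Newton–Leibniz-free
sub-calculus `C12 = AddSubgroup.closure (domainAddRel ∪ integrandAddRel ∪ changeOfVariablesRel)` of
the Kontsevich–Zagier calculus of `KZCalculus.lean`. All bookkeeping is therefore done for an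
arbitrary subgroup `S` of `KZ.FormalRep` containing the three scissors move sets (hypothesis
`hS : domainAddRel ∪ integrandAddRel ∪ changeOfVariablesRel ⊆ S`):

* `levelRel ≤ S` (coordinate permutations are changes of variables, `KZUnfolding.lean`), hence
  null domains, zero integrands and `[σ, f] + [σ, −f]` are in `S`;
* congruence of integrands on the domain, splitting a domain into two semialgebraic pieces with
  null overlap, and equality modulo `S` of representations whose domains differ by a null set;
* existence of the image / preimage of a representation under Kontsevich–Zagier change-of-variables
  data, the new representation being absolutely integrable by Mathlib's Jacobian formula
  (`MeasureTheory.integrableOn_image_iff_integrableOn_abs_det_fderiv_smul`).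

Everything here is elementary; the pattern is `KZLogCalculusProofs.lean` (which concludes in the
full group `KZ.relations`). [Kontsevich–Zagier 2001, §1.2, rules 1)–2)] [folklore]
-/

noncomputable section

open MeasureTheory Set
open Literature.NumberTheory.Transcendental Literature.ModelTheory.ExponentialFields

namespace Summit.KontsevichZagierPeriods.K2SymbolChains.JensenIsScissorsProof

open Literature.NumberTheory.Transcendental.KZ

variable {N : ℕ} {S : AddSubgroup FormalRep}

/-! ### Junk and congruence inside `S` -/

/-- The level moves (additivity and coordinate permutations) lie in every subgroup containing the
three scissors move sets. [Kontsevich–Zagier 2001, §1.2] [folklore] -/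
theorem levelRel_le (hS : domainAddRel ∪ integrandAddRel ∪ changeOfVariablesRel ⊆ S) :
    levelRel ≤ S := by
  rw [levelRel_def]
  refine (AddSubgroup.closure_le _).mpr ?_
  rintro c ((hc | hc) | hc)
  · exact hS (Or.inl (Or.inl hc))
  · exact hS (Or.inl (Or.inr hc))
  · exact hS (Or.inr (permRel_subset_changeOfVariablesRel hc))

/-- A representation over a null domain lies in `S`. [Kontsevich–Zagier 2001, §1.2, rule 1)]
[folklore] -/
theorem of_mem_of_volume_eq_zero (hS : domainAddRel ∪ integrandAddRel ∪ changeOfVariablesRel ⊆ S)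
    (r : IntegralRep N) (h : volume r.domain = 0) : of r ∈ S :=
  levelRel_le hS (of_mem_levelRel_of_volume_eq_zero r h)

/-- A representation whose integrand vanishes on its domain lies in `S`.
[Kontsevich–Zagier 2001, §1.2, rule 1)] [folklore] -/
theorem of_mem_of_eqOn_zero (hS : domainAddRel ∪ integrandAddRel ∪ changeOfVariablesRel ⊆ S)
    (r : IntegralRep N) (h : EqOn r.integrand 0 r.domain) : of r ∈ S :=
  levelRel_le hS (of_mem_levelRel_of_eqOn_zero r h)

/-- `[σ, f] + [σ, −f] ∈ S`. [Kontsevich–Zagier 2001, §1.2, rule 1)] [folklore] -/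
theorem of_add_of_neg_mem (hS : domainAddRel ∪ integrandAddRel ∪ changeOfVariablesRel ⊆ S)
    (r : IntegralRep N) : of r + of r.neg ∈ S :=
  levelRel_le hS (of_add_of_neg_mem_levelRel r)

/-- The zero representation on a semialgebraic set. [folklore] -/
theorem exists_zeroRep' {σ : Set (Fin N → ℝ)} (hσ : IsSemialgebraic ℚ σ) :
    ∃ z : IntegralRep N, z.domain = σ ∧ z.integrand = 0 :=
  exists_zeroRep hσ

/-- **Congruence**: representations with the same domain whose integrands agree on it differ by an
element of `S`. [Kontsevich–Zagier 2001, §1.2, rule 1)] [folklore] -/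
theorem of_sub_of_mem_of_eqOn (hS : domainAddRel ∪ integrandAddRel ∪ changeOfVariablesRel ⊆ S)
    {r r' : IntegralRep N} (hd : r'.domain = r.domain) (h : EqOn r.integrand r'.integrand r.domain) :
    of r - of r' ∈ S := by
  obtain ⟨z, hzd, hzi⟩ := exists_zeroRep r.isSemialgebraic_domain
  have h1 : of r - of r' - of z ∈ S :=
    hS (Or.inl (Or.inr ⟨N, r, r', z, hd, hzd, fun x hx => by simp [hzi, h hx], rfl⟩))
  have h2 : of z ∈ S := of_mem_of_eqOn_zero hS z (by simp [hzi, EqOn])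
  have : of r - of r' = (of r - of r' - of z) + of z := by abel
  rw [this]
  exact S.add_mem h1 h2

/-- Representations with the same domain and opposite integrands sum to an element of `S`.
[Kontsevich–Zagier 2001, §1.2, rule 1)] [folklore] -/
theorem of_add_of_mem_of_eqOn_neg (hS : domainAddRel ∪ integrandAddRel ∪ changeOfVariablesRel ⊆ S)
    {r r' : IntegralRep N} (hd : r'.domain = r.domain) (h : EqOn r'.integrand (-r.integrand) r.domain) :
    of r + of r' ∈ S := by
  have h1 : of r + of r.neg ∈ S := of_add_of_neg_mem hS r
  have h2 : of r.neg - of r' ∈ S :=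
    of_sub_of_mem_of_eqOn hS (by simp [hd]) (fun x hx => (h hx).symm)
  have : of r + of r' = (of r + of r.neg) - (of r.neg - of r') := by abel
  rw [this]
  exact S.sub_mem h1 h2

/-- Two integrand-additivity summands: if `r`, `r₁`, `r₂` share a domain on which
`r.integrand = r₁.integrand + r₂.integrand`, then `[r] − [r₁] − [r₂] ∈ S`.
[Kontsevich–Zagier 2001, §1.2, rule 1)] [folklore] -/
theorem of_sub_of_sub_mem_of_add (hS : domainAddRel ∪ integrandAddRel ∪ changeOfVariablesRel ⊆ S)
    {r r₁ r₂ : IntegralRep N} (h₁ : r₁.domain = r.domain) (h₂ : r₂.domain = r.domain)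
    (h : EqOn r.integrand (r₁.integrand + r₂.integrand) r.domain) :
    of r - of r₁ - of r₂ ∈ S :=
  hS (Or.inl (Or.inr ⟨N, r, r₁, r₂, h₁, h₂, h, rfl⟩))

/-! ### Splitting domains -/

/-- **Splitting a domain** into two semialgebraic pieces with null overlap (the integrands of the
pieces agreeing with that of `r`): `[r] − [r₁] − [r₂] ∈ S`.
[Kontsevich–Zagier 2001, §1.2, rule 1)] [folklore] -/
theorem of_sub_of_sub_mem_of_union (hS : domainAddRel ∪ integrandAddRel ∪ changeOfVariablesRel ⊆ S)
    {r r₁ r₂ : IntegralRep N} (hdom : r.domain = r₁.domain ∪ r₂.domain)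
    (hnull : volume (r₁.domain ∩ r₂.domain) = 0) (h₁ : EqOn r.integrand r₁.integrand r₁.domain)
    (h₂ : EqOn r.integrand r₂.integrand r₂.domain) : of r - of r₁ - of r₂ ∈ S :=
  hS (Or.inl (Or.inl ⟨N, r, r₁, r₂, hdom, hnull, h₁, h₂, rfl⟩))

/-- Splitting a representation along a cover of its domain by two semialgebraic subsets with null
overlap, the pieces being the restrictions. [Kontsevich–Zagier 2001, §1.2, rule 1)] [folklore] -/
theorem of_sub_restrict_sub_restrict_mem
    (hS : domainAddRel ∪ integrandAddRel ∪ changeOfVariablesRel ⊆ S) (r : IntegralRep N)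
    {A B : Set (Fin N → ℝ)} (hA : IsSemialgebraic ℚ A) (hB : IsSemialgebraic ℚ B)
    (hAr : A ⊆ r.domain) (hBr : B ⊆ r.domain) (hcover : r.domain ⊆ A ∪ B)
    (hnull : volume (A ∩ B) = 0) :
    of r - of (r.restrict A hA hAr) - of (r.restrict B hB hBr) ∈ S :=
  of_sub_of_sub_mem_of_union hS
    (by simpa using subset_antisymm hcover (union_subset hAr hBr)) (by simpa using hnull)
    (fun _ _ => rfl) (fun _ _ => rfl)

/-- Splitting a representation along a semialgebraic subset `A` of the ambient space: the pieces
over `domain ∩ A` and `domain \ A`. [Kontsevich–Zagier 2001, §1.2, rule 1)] [folklore] -/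
theorem of_sub_restrict_inter_sub_restrict_diff_mem
    (hS : domainAddRel ∪ integrandAddRel ∪ changeOfVariablesRel ⊆ S) (r : IntegralRep N)
    {A : Set (Fin N → ℝ)} (hA : IsSemialgebraic ℚ A) :
    of r - of (r.restrict (r.domain ∩ A) (r.isSemialgebraic_domain.inter hA) inter_subset_left) -
      of (r.restrict (r.domain \ A) (r.isSemialgebraic_domain.diff hA) sdiff_subset) ∈ S :=
  of_sub_restrict_sub_restrict_mem hS r _ _ _ _
    (fun x hx => by
      by_cases h : x ∈ A
      · exact Or.inl ⟨hx, h⟩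
      · exact Or.inr ⟨hx, h⟩)
    (by rw [show (r.domain ∩ A) ∩ (r.domain \ A) = ∅ by ext; simp; tauto, measure_empty])

/-- **Null differences are invisible**: if `r'.domain ⊆ r.domain`, the difference is null and the
integrands agree on `r'.domain`, then `[r] − [r'] ∈ S`. [Kontsevich–Zagier 2001, §1.2, rule 1)]
[folklore] -/
theorem of_sub_of_mem_of_subset (hS : domainAddRel ∪ integrandAddRel ∪ changeOfVariablesRel ⊆ S)
    {r r' : IntegralRep N} (hsub : r'.domain ⊆ r.domain) (hnull : volume (r.domain \ r'.domain) = 0)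
    (h : EqOn r.integrand r'.integrand r'.domain) : of r - of r' ∈ S := by
  set r₂ := r.restrict (r.domain \ r'.domain) (r.isSemialgebraic_domain.diff r'.isSemialgebraic_domain)
    sdiff_subset with hr₂
  have h1 : of r - of r' - of r₂ ∈ S :=
    of_sub_of_sub_mem_of_union hS (by simp [hr₂, union_sdiff_cancel hsub])
      (by simp [hr₂]) h (fun _ _ => rfl)
  have h2 : of r₂ ∈ S := of_mem_of_volume_eq_zero hS r₂ (by simpa [hr₂] using hnull)
  have : of r - of r' = (of r - of r' - of r₂) + of r₂ := by abel
  rw [this]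
  exact S.add_mem h1 h2

/-- Representations whose domains differ by null sets (in both directions) and whose integrands agree
on the common part differ by an element of `S`. [Kontsevich–Zagier 2001, §1.2, rule 1)] [folklore] -/
theorem of_sub_of_mem_of_symmDiff (hS : domainAddRel ∪ integrandAddRel ∪ changeOfVariablesRel ⊆ S)
    {r r' : IntegralRep N} (h₁ : volume (r.domain \ r'.domain) = 0)
    (h₂ : volume (r'.domain \ r.domain) = 0)
    (h : EqOn r.integrand r'.integrand (r.domain ∩ r'.domain)) : of r - of r' ∈ S := by
  have hI : IsSemialgebraic ℚ (r.domain ∩ r'.domain) :=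
    r.isSemialgebraic_domain.inter r'.isSemialgebraic_domain
  set r₀ := r.restrict (r.domain ∩ r'.domain) hI inter_subset_left with hr₀
  set r₀' := r'.restrict (r.domain ∩ r'.domain) hI inter_subset_right with hr₀'
  have e1 : of r - of r₀ ∈ S :=
    of_sub_of_mem_of_subset hS inter_subset_left (by simpa [hr₀, sdiff_self_inter] using h₁)
      (fun _ _ => rfl)
  have e2 : of r' - of r₀' ∈ S :=
    of_sub_of_mem_of_subset hS inter_subset_right
      (by simpa [hr₀', inter_comm, sdiff_self_inter] using h₂) (fun _ _ => rfl)
  have e3 : of r₀ - of r₀' ∈ S := of_sub_of_mem_of_eqOn hS rfl h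
  have : of r - of r' = (of r - of r₀) + (of r₀ - of r₀') - (of r' - of r₀') := by abel
  rw [this]
  exact S.sub_mem (S.add_mem e1 e3) e2

/-! ### Images and preimages under a change of variables -/

/-- **The image of a representation under change-of-variables data exists**: given `r`, a
`ℚ`-semialgebraic injective `Φ` on `r.domain` with derivative `Φ'` within the domain, and a
`ℚ`-semialgebraic `f'` on `Φ '' r.domain` with `r.integrand = (f' ∘ Φ) · |det Φ'|` on the domain,
there is a representation `r'` with domain `Φ '' r.domain` and integrand `f'` (absolutely integrable
by the Jacobian formula), and `[r] − [r']` is an instance of rule 2).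
[Kontsevich–Zagier 2001, §1.2, rule 2)] [folklore] -/
theorem exists_image_rep (r : IntegralRep N) {Φ : (Fin N → ℝ) → (Fin N → ℝ)}
    {Φ' : (Fin N → ℝ) → (Fin N → ℝ) →L[ℝ] (Fin N → ℝ)} (hΦ : IsSemialgebraicMapOn ℚ r.domain Φ)
    (hΦ' : ∀ x ∈ r.domain, HasFDerivWithinAt Φ (Φ' x) r.domain x) (hinj : InjOn Φ r.domain)
    {f' : (Fin N → ℝ) → ℝ} (hf' : IsSemialgebraicFunOn ℚ (Φ '' r.domain) f')
    (hff' : ∀ x ∈ r.domain, r.integrand x = f' (Φ x) * |(Φ' x).det|) :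
    ∃ r' : IntegralRep N, r'.domain = Φ '' r.domain ∧ r'.integrand = f' ∧
      of r - of r' ∈ changeOfVariablesRel := by
  have hm : MeasurableSet r.domain := IntegralRep.measurableSet_domain_holds r
  have hint : IntegrableOn f' (Φ '' r.domain) := by
    rw [integrableOn_image_iff_integrableOn_abs_det_fderiv_smul volume hm hΦ' hinj]
    refine r.integrableOn.congr_fun (fun x hx => ?_) hm
    rw [hff' x hx, smul_eq_mul, mul_comm]
  refine ⟨⟨Φ '' r.domain, f', IsSemialgebraicMapOn.isSemialgebraic_image_holds hΦ subset_rfl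
    r.isSemialgebraic_domain, hf', hint⟩, rfl, rfl, ?_⟩
  exact ⟨N, r, _, Φ, Φ', hΦ, hΦ', hinj, rfl, hff', rfl⟩

/-- **The preimage of a representation under change-of-variables data exists**: given `r'`, a
`ℚ`-semialgebraic `σ` with `ℚ`-semialgebraic injective `Φ` on `σ`, derivative `Φ'` within `σ`,
`Φ '' σ = r'.domain`, and a `ℚ`-semialgebraic `f` on `σ` with `f = (r'.integrand ∘ Φ) · |det Φ'|`,
there is a representation `r` with domain `σ` and integrand `f`, and `[r] − [r']` is an instance of
rule 2). [Kontsevich–Zagier 2001, §1.2, rule 2)] [folklore] -/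
theorem exists_preimage_rep (r' : IntegralRep N) {σ : Set (Fin N → ℝ)} (hσ : IsSemialgebraic ℚ σ)
    {Φ : (Fin N → ℝ) → (Fin N → ℝ)} {Φ' : (Fin N → ℝ) → (Fin N → ℝ) →L[ℝ] (Fin N → ℝ)}
    (hΦ : IsSemialgebraicMapOn ℚ σ Φ) (hΦ' : ∀ x ∈ σ, HasFDerivWithinAt Φ (Φ' x) σ x)
    (hinj : InjOn Φ σ) (himg : Φ '' σ = r'.domain) {f : (Fin N → ℝ) → ℝ}
    (hf : IsSemialgebraicFunOn ℚ σ f) (hff' : ∀ x ∈ σ, f x = r'.integrand (Φ x) * |(Φ' x).det|) :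
    ∃ r : IntegralRep N, r.domain = σ ∧ r.integrand = f ∧ of r - of r' ∈ changeOfVariablesRel := by
  have hm : MeasurableSet σ := IsSemialgebraic.measurableSet_holds hσ
  have hint : IntegrableOn f σ := by
    have h := r'.integrableOn
    rw [← himg, integrableOn_image_iff_integrableOn_abs_det_fderiv_smul volume hm hΦ' hinj] at h
    refine h.congr_fun (fun x hx => ?_) hm
    simp only [hff' x hx, smul_eq_mul, mul_comm]
  exact ⟨⟨σ, f, hσ, hf, hint⟩, rfl, rfl, ⟨N, _, r', Φ, Φ', hΦ, hΦ', hinj, himg.symm, hff', rfl⟩⟩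

/-- Rule 2) instances lie in `S`. [Kontsevich–Zagier 2001, §1.2, rule 2)] [folklore] -/
theorem mem_of_mem_changeOfVariablesRel
    (hS : domainAddRel ∪ integrandAddRel ∪ changeOfVariablesRel ⊆ S) {c : FormalRep}
    (hc : c ∈ changeOfVariablesRel) : c ∈ S :=
  hS (Or.inr hc)

/-! ### Restricting to pieces of a base -/

/-- The cylinder `{z | init z ∈ P}` over a `ℚ`-semialgebraic `P` is `ℚ`-semialgebraic. [folklore] -/
theorem isSemialgebraic_cyl {m : ℕ} {P : Set (Fin m → ℝ)} (hP : IsSemialgebraic ℚ P) :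
    IsSemialgebraic ℚ {z : Fin (m + 1) → ℝ | Fin.init z ∈ P} :=
  hP.setOf_init_mem

/-- **Splitting over the base**: for a representation in dimension `m + 1` and a semialgebraic
subset `P` of the base, `[r] − [r | init ∈ P] − [r | init ∉ P] ∈ S`.
[Kontsevich–Zagier 2001, §1.2, rule 1)] [folklore] -/
theorem of_sub_restrict_base_mem {m : ℕ}
    (hS : domainAddRel ∪ integrandAddRel ∪ changeOfVariablesRel ⊆ S) (r : IntegralRep (m + 1))
    {P : Set (Fin m → ℝ)} (hP : IsSemialgebraic ℚ P) :
    of r - of (r.restrict (r.domain ∩ {z | Fin.init z ∈ P})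
        (r.isSemialgebraic_domain.inter (isSemialgebraic_cyl hP)) inter_subset_left) -
      of (r.restrict (r.domain \ {z | Fin.init z ∈ P})
        (r.isSemialgebraic_domain.diff (isSemialgebraic_cyl hP)) sdiff_subset) ∈ S :=
  of_sub_restrict_inter_sub_restrict_diff_mem hS r (isSemialgebraic_cyl hP)

/-- A representation whose base part `{init z | z ∈ domain}` lies over a null set is in `S`
(cylinders over null sets are null). [Kontsevich–Zagier 2001, §1.2, rule 1)] [folklore] -/
theorem of_mem_of_base_null {m : ℕ}
    (hS : domainAddRel ∪ integrandAddRel ∪ changeOfVariablesRel ⊆ S) (r : IntegralRep (m + 1))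
    {Z : Set (Fin m → ℝ)} (hZ : volume Z = 0) (hr : r.domain ⊆ {z | Fin.init z ∈ Z}) : of r ∈ S :=
  of_mem_of_volume_eq_zero hS r (measure_mono_null hr (volume_setOf_init_mem_eq_zero hZ))

end Summit.KontsevichZagierPeriods.K2SymbolChains.JensenIsScissorsProof
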